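import Literature.Geometry.Lorentzian.CoordStarQuad
import HarnessLib

/-!
# The evolution of `∇^k Rm` under the Ricci flow: `∂_t ∇^kRm = Δ∇^kRm + Σ ∇^jRm * ∇^{k−j}Rm`

Sixth layer of the rank-generic coordinate tensor calculus, towards Shi's global derivative
estimates (Topping 2006, Thm. 3.3.1) and the curvature blow-up theorem (Thm. 5.3.1): along a
solution of the Ricci flow in coordinates (`IsMetricFamilyOn G S V` with `∂_t G = −2 Ric`),

* the **bridges** between the component calculus and the bundled curvature calculus of
  `CoordBianchi.lean` / `CoordCurvatureRicciIdentity.lean` / `CoordCurvatureLaplacian.lean`: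
  `(∇ rm4)_{q,jkim} = G((∇_{b_q}R)(b_j,b_k)b_i, b_m)`, `(∇∇ rm4)_{pq,jkim} = G((∇²_{b_p,b_q}R)(b_j,b_k)b_i, b_m)`,
  `(Δ rm4)_{jkim} = G((ΔR)(b_j,b_k)b_i, b_m)`;
* **the base case** `curvL 0 = ∂_tRm − ΔRm ∈ StarQuad 0` (Topping, Prop. 2.5.1 / Remark 2.5.2:
  `∂_t Rm = ΔRm + Rm * Rm`, from `hasDerivWithinAt_apply_riemAt_ricciFlow`);
* **the induction step** and **`starQuad_curvL : ∀ k, curvL k ∈ StarQuad k`** (Topping, (3.3.3):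
  `∂_t ∇^kRm = Δ(∇^kRm) + Σ_j ∇^jRm * ∇^{k−j}Rm`, via `(∂_t∇ − ∇∂_t)A = A * ∇Rm` ((2.3.3)) and
  `∇(ΔA) − Δ(∇A) = Rm * ∇A + ∇Rm * A` ((2.1.6)));
* **the scalar evolution inequality for `u_k = |∇^kRm|²`** (Topping, (3.3.4) for all `k`):
  `∂_t u_k ≤ Δu_k − 2u_{k+1} + C Σ_p √u_p √u_{k−p} √u_k + C √u_0 u_k`.

Everything is proved; no definition of `Prop` type.

## References

* P. Topping, *Lectures on the Ricci flow*, LMS Lecture Note Series 325, CUP 2006, (2.1.6),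
  (2.3.3), Prop. 2.5.1, Remark 2.5.2, §3.3 (Thm. 3.3.1, (3.3.3)–(3.3.4)). [Topping2006]
* R. S. Hamilton, *Three-manifolds with positive Ricci curvature*, J. Differential Geom. 17
  (1982), §13. [Hamilton1982]
-/

noncomputable section

set_option maxSynthPendingDepth 3

open Set Filter ContinuousLinearMap Module Function
open scoped Topology ContDiff

namespace Literature.Geometry.Lorentzian

namespace MetricCoord

variable {E : Type*} [NormedAddCommGroup E] [NormedSpace ℝ E] {ι : Type*}

/-! ### Bridges: `∇ rm4`, `∇∇ rm4` and `Δ rm4` through `covRiemAt`, `cov2RiemAt`, `lapRiemAt` -/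

section Bridge

variable [Fintype ι] {G : E → E →L[ℝ] E →L[ℝ] ℝ} (b : Basis ι ℝ E) {V : Set E} {x : E} [CompleteSpace E]

omit [Fintype ι] [CompleteSpace E] in
/-- Updating slot `0` of an explicit index vector of length four. [folklore] -/
theorem update_vec4_zero (j k i m m' : ι) : (update ![j, k, i, m] 0 m' : Fin 4 → ι) = ![m', k, i, m] := by
  funext c; fin_cases c <;> rfl

omit [Fintype ι] [CompleteSpace E] in
/-- Updating slot `1` of an explicit index vector of length four. [folklore] -/
theorem update_vec4_one (j k i m m' : ι) : (update ![j, k, i, m] 1 m' : Fin 4 → ι) = ![j, m', i, m] := by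
  funext c; fin_cases c <;> rfl

omit [Fintype ι] [CompleteSpace E] in
/-- Updating slot `2` of an explicit index vector of length four. [folklore] -/
theorem update_vec4_two (j k i m m' : ι) : (update ![j, k, i, m] 2 m' : Fin 4 → ι) = ![j, k, m', m] := by
  funext c; fin_cases c <;> rfl

omit [Fintype ι] [CompleteSpace E] in
/-- Updating slot `3` of an explicit index vector of length four. [folklore] -/
theorem update_vec4_three (j k i m m' : ι) : (update ![j, k, i, m] 3 m' : Fin 4 → ι) = ![j, k, i, m'] := by
  funext c; fin_cases c <;> rfl

omit [Fintype ι] [CompleteSpace E] in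
/-- Every index function on `Fin 4` is an explicit vector. [folklore] -/
theorem eq_vec4 (J : Fin 4 → ι) : J = ![J 0, J 1, J 2, J 3] := by
  funext c; fin_cases c <;> rfl

omit [Fintype ι] [CompleteSpace E] in
/-- `y ↦ G_y(u(y), W)` has derivative `G(∂u, W) + (∂G)(u, W)`. [folklore] -/
theorem fderiv_apply_apply {u : E → E} (hGd : DifferentiableAt ℝ G x) (hu : DifferentiableAt ℝ u x) (W v : E) :
    fderiv ℝ (fun y ↦ G y (u y) W) x v = G x (fderiv ℝ u x v) W + fderiv ℝ G x v (u x) W := by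
  have h1 := hGd.hasFDerivAt.clm_apply hu.hasFDerivAt
  have h2 := hasFDerivAt_clm_apply_const h1 W
  rw [h2.fderiv]
  simp only [ContinuousLinearMap.flip_apply, _root_.add_apply, ContinuousLinearMap.comp_apply]

/-- **`(∇ rm4)_{q,(j,k,i,m)} = G((∇_{b_q}R)(b_j,b_k) b_i, b_m)`**: the component covariant derivative
of the lowered curvature tensor is the lowered `covRiemAt` (`∇G = 0`). [cite: ONeill1983, Ch. 3, Prop. 3.37] -/
theorem IsMetricOn.tcov_rm4 (hG : IsMetricOn G V) (hx : x ∈ V) (q j k i m : ι) :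
    tcov G b (rm4 G b) x (ocons q ![j, k, i, m]) = G x (covRiemAt G x (b q) (b j) (b k) (b i)) (b m) := by
  have hi := hG.isInvertible x hx
  have hGd := hG.differentiableAt hx
  have hRd : DifferentiableAt ℝ (fun y ↦ riemAt G y (b j) (b k) (b i)) x :=
    ((hG.contDiffOn_riemAt_apply _ _ _).contDiffAt (hG.isOpen.mem_nhds hx)).differentiableAt (by simp)
  have hR2d : DifferentiableAt ℝ (fun y ↦ riemAt G y (b j) (b k)) x :=
    ((hG.contDiffOn_riemAt _ _).contDiffAt (hG.isOpen.mem_nhds hx)).differentiableAt (by simp)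
  rw [tcov_apply_ocons, Fin.sum_univ_four]
  simp only [Matrix.cons_val_zero, Matrix.cons_val_one, Matrix.cons_val, rm4_vec, update_vec4_zero,
    update_vec4_one, update_vec4_two, update_vec4_three]
  -- linearity in the four slots
  have hj : G x (riemAt G x (chrAt G x (b q) (b j)) (b k) (b i)) (b m) =
      ∑ m', chrCoef G b x q j m' * G x (riemAt G x (b m') (b k) (b i)) (b m) := by
    rw [chrAt_basis_eq_sum b x q j, ← riemCLM_apply]
    simp only [map_sum, map_smul, _root_.sum_apply, _root_.smul_apply, smul_eq_mul, riemCLM_apply]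
  have hk : G x (riemAt G x (b j) (chrAt G x (b q) (b k)) (b i)) (b m) =
      ∑ m', chrCoef G b x q k m' * G x (riemAt G x (b j) (b m') (b i)) (b m) := by
    rw [chrAt_basis_eq_sum b x q k, ← riemCLM_apply]
    simp only [map_sum, map_smul, _root_.sum_apply, _root_.smul_apply, smul_eq_mul, riemCLM_apply]
  have hi' : G x (riemAt G x (b j) (b k) (chrAt G x (b q) (b i))) (b m) =
      ∑ m', chrCoef G b x q i m' * G x (riemAt G x (b j) (b k) (b m')) (b m) := by
    rw [chrAt_basis_eq_sum b x q i]
    simp only [map_sum, map_smul, _root_.sum_apply, _root_.smul_apply, smul_eq_mul]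
  have hm : G x (riemAt G x (b j) (b k) (b i)) (chrAt G x (b q) (b m)) =
      ∑ m', chrCoef G b x q m m' * G x (riemAt G x (b j) (b k) (b i)) (b m') := by
    rw [chrAt_basis_eq_sum b x q m]
    simp only [map_sum, map_smul, smul_eq_mul]
  rw [← hj, ← hk, ← hi', ← hm, fderiv_apply_apply hGd hRd, fderiv_clm_apply_const hR2d (b i) (b q),
    hG.fderiv_eq_chrAt hx, covRiemAt_apply]
  simp only [map_add, map_sub, _root_.add_apply, _root_.sub_apply]
  ring

/-- The bridge `tcov_rm4` as an identity of functions of `y` near `x` (for every index function).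
[cite: ONeill1983, Ch. 3, Prop. 3.37] -/
theorem IsMetricOn.tcov_rm4_eventuallyEq (hG : IsMetricOn G V) (hx : x ∈ V) (q : ι) (J : Fin 4 → ι) :
    (fun y ↦ tcov G b (rm4 G b) y (ocons q J)) =ᶠ[𝓝 x]
      fun y ↦ G y (covRiemAt G y (b q) (b (J 0)) (b (J 1)) (b (J 2))) (b (J 3)) := by
  filter_upwards [hG.isOpen.mem_nhds hx] with y hy
  conv_lhs => rw [eq_vec4 J]
  exact hG.tcov_rm4 b hy q (J 0) (J 1) (J 2) (J 3)

/-- `(∇_W R)(Σ c_i v_i, Y) = Σ c_i (∇_W R)(v_i, Y)`. [folklore] -/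
theorem IsMetricOn.covRiemAt_sum_smul_mid {κ : Type*} (hG : IsMetricOn G V) (hx : x ∈ V) (s : Finset κ)
    (c : κ → ℝ) (v : κ → E) (W Y : E) :
    covRiemAt G x W (∑ a ∈ s, c a • v a) Y = ∑ a ∈ s, c a • covRiemAt G x W (v a) Y := by
  classical
  induction s using Finset.induction_on with
  | empty =>
    simp only [Finset.sum_empty]
    rw [show (0 : E) = (0 : ℝ) • W by simp, hG.covRiemAt_smul_mid hx, zero_smul]
  | insert a s ha ih =>
    rw [Finset.sum_insert ha, Finset.sum_insert ha, hG.covRiemAt_add_mid hx, hG.covRiemAt_smul_mid hx, ih]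

/-- `(∇_W R)(Y, Σ c_i v_i) = Σ c_i (∇_W R)(Y, v_i)`. [folklore] -/
theorem IsMetricOn.covRiemAt_sum_smul_right {κ : Type*} (hG : IsMetricOn G V) (hx : x ∈ V) (s : Finset κ)
    (c : κ → ℝ) (v : κ → E) (W Y : E) :
    covRiemAt G x W Y (∑ a ∈ s, c a • v a) = ∑ a ∈ s, c a • covRiemAt G x W Y (v a) := by
  classical
  induction s using Finset.induction_on with
  | empty =>
    simp only [Finset.sum_empty]
    rw [show (0 : E) = (0 : ℝ) • W by simp, hG.covRiemAt_smul_right hx, zero_smul]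
  | insert a s ha ih =>
    rw [Finset.sum_insert ha, Finset.sum_insert ha, hG.covRiemAt_add_right hx, hG.covRiemAt_smul_right hx, ih]

/-- **`(∇∇ rm4)_{p,q,(j,k,i,m)} = G((∇²_{b_p,b_q}R)(b_j,b_k) b_i, b_m)`.** [cite: Topping2006, §2.1] -/
theorem IsMetricOn.tcov_tcov_rm4 (hG : IsMetricOn G V) (hx : x ∈ V) (p q j k i m : ι) :
    tcov G b (tcov G b (rm4 G b)) x (ocons p (ocons q ![j, k, i, m])) =
      G x (cov2RiemAt G x (b p) (b q) (b j) (b k) (b i)) (b m) := by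
  have hGd := hG.differentiableAt hx
  have hCd : DifferentiableAt ℝ (fun y ↦ covRiemAt G y (b q) (b j) (b k)) x :=
    hG.differentiableAt_covRiemAt hx _ _ _
  have hCvd : DifferentiableAt ℝ (fun y ↦ covRiemAt G y (b q) (b j) (b k) (b i)) x :=
    differentiableAt_clm_apply_const hCd (b i)
  rw [tcov_apply_ocons, Fintype.sum_option, Fin.sum_univ_four]
  simp only [ocons_none, ocons_some, update_ocons_none, update_ocons_some, Matrix.cons_val_zero,
    Matrix.cons_val_one, Matrix.cons_val, update_vec4_zero, update_vec4_one, update_vec4_two,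
    update_vec4_three]
  -- the inner `∇ rm4` through `covRiemAt`, also inside the derivative
  rw [(hG.tcov_rm4_eventuallyEq b hx q ![j, k, i, m]).fderiv_eq]
  simp only [hG.tcov_rm4 b hx, Matrix.cons_val_zero, Matrix.cons_val_one, Matrix.cons_val]
  -- linearity in the five slots
  have hq : G x (covRiemAt G x (chrAt G x (b p) (b q)) (b j) (b k) (b i)) (b m) =
      ∑ m', chrCoef G b x p q m' * G x (covRiemAt G x (b m') (b j) (b k) (b i)) (b m) := by
    rw [chrAt_basis_eq_sum b x p q, ← hG.covRiemCLM_apply hx]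
    simp only [map_sum, map_smul, _root_.sum_apply, _root_.smul_apply, smul_eq_mul, hG.covRiemCLM_apply hx]
  have hj : G x (covRiemAt G x (b q) (chrAt G x (b p) (b j)) (b k) (b i)) (b m) =
      ∑ m', chrCoef G b x p j m' * G x (covRiemAt G x (b q) (b m') (b k) (b i)) (b m) := by
    rw [chrAt_basis_eq_sum b x p j, hG.covRiemAt_sum_smul_mid hx]
    simp only [FunLike.coe_sum, Finset.sum_apply, _root_.smul_apply, map_sum, map_smul, smul_eq_mul]
  have hk : G x (covRiemAt G x (b q) (b j) (chrAt G x (b p) (b k)) (b i)) (b m) =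
      ∑ m', chrCoef G b x p k m' * G x (covRiemAt G x (b q) (b j) (b m') (b i)) (b m) := by
    rw [chrAt_basis_eq_sum b x p k, hG.covRiemAt_sum_smul_right hx]
    simp only [FunLike.coe_sum, Finset.sum_apply, _root_.smul_apply, map_sum, map_smul, smul_eq_mul]
  have hi' : G x (covRiemAt G x (b q) (b j) (b k) (chrAt G x (b p) (b i))) (b m) =
      ∑ m', chrCoef G b x p i m' * G x (covRiemAt G x (b q) (b j) (b k) (b m')) (b m) := by
    rw [chrAt_basis_eq_sum b x p i]
    simp only [map_sum, map_smul, _root_.sum_apply, _root_.smul_apply, smul_eq_mul]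
  have hm : G x (covRiemAt G x (b q) (b j) (b k) (b i)) (chrAt G x (b p) (b m)) =
      ∑ m', chrCoef G b x p m m' * G x (covRiemAt G x (b q) (b j) (b k) (b i)) (b m') := by
    rw [chrAt_basis_eq_sum b x p m]
    simp only [map_sum, map_smul, smul_eq_mul]
  rw [← hq, ← hj, ← hk, ← hi', ← hm, fderiv_apply_apply hGd hCvd, fderiv_clm_apply_const hCd (b i) (b p),
    hG.fderiv_eq_chrAt hx, cov2RiemAt_def]
  simp only [map_add, map_sub, _root_.add_apply, _root_.sub_apply, ContinuousLinearMap.comp_apply]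
  ring

/-- **`(Δ rm4)_{(j,k,i,m)} = G((ΔR)(b_j,b_k) b_i, b_m)`** (`ΔR = lapRiemAt`, the rough Laplacian of the
curvature endomorphism). [cite: Topping2006, §2.1] -/
theorem IsMetricOn.tlap_rm4 [FiniteDimensional ℝ E] (hG : IsMetricOn G V) (hx : x ∈ V) (j k i m : ι) :
    tlap G b (rm4 G b) x ![j, k, i, m] = G x (lapRiemAt G b x (b j) (b k) (b i)) (b m) := by
  rw [tlap_apply, lapRiemAt]
  simp only [hG.tcov_tcov_rm4 b hx, FunLike.coe_sum, Finset.sum_apply, map_sum, _root_.smul_apply,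
    map_smul, smul_eq_mul]

end Bridge

/-! ### `Rm * Rm` monomials: double traces of relabelled `rm4 ⊗ rm4` -/

section Monomials

variable [Fintype ι] {G : E → E →L[ℝ] E →L[ℝ] ℝ} (b : Basis ι ℝ E) {V : Set E} {x : E} [FiniteDimensional ℝ E]

/-- The index function `(r, s, p, q, I)` on `Option⁴ (Fin 4)` read by a double trace. [folklore] -/
def oconsFour (r s p q : ι) (I : Fin 4 → ι) : Option (Option (Option (Option (Fin 4)))) → ι :=
  ocons r (ocons s (ocons p (ocons q I)))

/-- **Evaluation of a double trace of a relabelled product**: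
`tr tr ((S ⊗ T) ∘ e)_I = Σ_{pq} g^{pq} Σ_{rs} g^{rs} S_{(rspqI) ∘ e ∘ inl} T_{(rspqI) ∘ e ∘ inr}`. [folklore] -/
theorem ttr_ttr_treindex_tprod {α β : Type*} (e : α ⊕ β ≃ Option (Option (Option (Option (Fin 4)))))
    (S : E → (α → ι) → ℝ) (T : E → (β → ι) → ℝ) (x : E) (I : Fin 4 → ι) :
    ttr G b (ttr G b (treindex e (tprod S T))) x I =
      ∑ p, ∑ q, ginv G b x p q * ∑ r, ∑ s, ginv G b x r s *
        (S x ((oconsFour r s p q I ∘ e) ∘ Sum.inl) * T x ((oconsFour r s p q I ∘ e) ∘ Sum.inr)) := by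
  rfl

/-- Positions in `Option⁴ (Fin 4)`: the two traced pairs `r, s, p, q` and the four free slots. [folklore] -/
def rrPos : Fin 8 → Option (Option (Option (Option (Fin 4)))) :=
  ![none, some none, some (some none), some (some (some none)),
    some (some (some (some 0))), some (some (some (some 1))), some (some (some (some 2))), some (some (some (some 3)))]

/-- The relabelling of `rm4 ⊗ rm4` with slot positions `cA` (first factor) and `cB` (second factor),
given as codes `0..7 = r, s, p, q, I₀, I₁, I₂, I₃`. [folklore] -/
def rrMap (cA cB : Fin 4 → Fin 8) : Fin 4 ⊕ Fin 4 → Option (Option (Option (Option (Fin 4)))) :=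
  Sum.elim (rrPos ∘ cA) (rrPos ∘ cB)

/-- The monomial `Q₁ = Σ g^{pq} g^{rs} R_{kqis} R_{pjrm}`. [cite: Topping2006, §2.4, (2.4.2)] -/
def rrEquiv₁ : Fin 4 ⊕ Fin 4 ≃ Option (Option (Option (Option (Fin 4)))) :=
  Equiv.ofBijective (rrMap ![5, 3, 6, 1] ![2, 4, 0, 7]) (by decide)

/-- The monomial `Q₂ = Σ g^{pq} g^{rs} R_{pjis} R_{kqrm}`. [cite: Topping2006, §2.4, (2.4.2)] -/
def rrEquiv₂ : Fin 4 ⊕ Fin 4 ≃ Option (Option (Option (Option (Fin 4)))) :=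
  Equiv.ofBijective (rrMap ![2, 4, 6, 1] ![5, 3, 0, 7]) (by decide)

/-- The monomial `Q₃ = Σ g^{pq} g^{rs} R_{pjks} R_{rqim}`. [cite: Topping2006, §2.4, (2.4.2)] -/
def rrEquiv₃ : Fin 4 ⊕ Fin 4 ≃ Option (Option (Option (Option (Fin 4)))) :=
  Equiv.ofBijective (rrMap ![2, 4, 5, 1] ![0, 3, 6, 7]) (by decide)

/-- The monomial `Q₄ = Σ g^{pq} g^{rs} R_{pjqs} R_{krim}`. [cite: Topping2006, §2.4, (2.4.2)] -/
def rrEquiv₄ : Fin 4 ⊕ Fin 4 ≃ Option (Option (Option (Option (Fin 4)))) :=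
  Equiv.ofBijective (rrMap ![2, 4, 3, 1] ![5, 0, 6, 7]) (by decide)

/-- The monomial `Ric(R(b_j,b_k)b_i, b_m) = Σ g^{pq} g^{rs} R_{jkis} R_{prmq}`. [cite: Topping2006, Prop. 2.5.1] -/
def rrEquiv₅ : Fin 4 ⊕ Fin 4 ≃ Option (Option (Option (Option (Fin 4)))) :=
  Equiv.ofBijective (rrMap ![4, 5, 6, 1] ![2, 0, 7, 3]) (by decide)

/-- The monomial `Ric(b_i, R(b_j,b_k)b_m) = Σ g^{pq} g^{rs} R_{jkms} R_{pirq}`. [cite: Topping2006, Prop. 2.5.1] -/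
def rrEquiv₆ : Fin 4 ⊕ Fin 4 ≃ Option (Option (Option (Option (Fin 4)))) :=
  Equiv.ofBijective (rrMap ![4, 5, 7, 1] ![2, 6, 0, 3]) (by decide)

/-- The double trace of `rm4 ⊗ rm4` relabelled along `e`. [cite: Topping2006, §2.2] -/
def rrField (G : E → E →L[ℝ] E →L[ℝ] ℝ) (b : Basis ι ℝ E) (e : Fin 4 ⊕ Fin 4 ≃ Option (Option (Option (Option (Fin 4))))) :
    E → (Fin 4 → ι) → ℝ :=
  ttr G b (ttr G b (treindex e (tprod (rm4 G b) (rm4 G b))))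

/-- **Evaluation of the six monomials.** [cite: Topping2006, §2.4, (2.4.2)] -/
theorem rrField_apply_all (x : E) (j k i m : ι) :
    rrField G b rrEquiv₁ x ![j, k, i, m] = ∑ p, ∑ q, ginv G b x p q * ∑ r, ∑ s, ginv G b x r s *
        (rm4 G b x ![k, q, i, s] * rm4 G b x ![p, j, r, m]) ∧
    rrField G b rrEquiv₂ x ![j, k, i, m] = ∑ p, ∑ q, ginv G b x p q * ∑ r, ∑ s, ginv G b x r s *
        (rm4 G b x ![p, j, i, s] * rm4 G b x ![k, q, r, m]) ∧
    rrField G b rrEquiv₃ x ![j, k, i, m] = ∑ p, ∑ q, ginv G b x p q * ∑ r, ∑ s, ginv G b x r s *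
        (rm4 G b x ![p, j, k, s] * rm4 G b x ![r, q, i, m]) ∧
    rrField G b rrEquiv₄ x ![j, k, i, m] = ∑ p, ∑ q, ginv G b x p q * ∑ r, ∑ s, ginv G b x r s *
        (rm4 G b x ![p, j, q, s] * rm4 G b x ![k, r, i, m]) ∧
    rrField G b rrEquiv₅ x ![j, k, i, m] = ∑ p, ∑ q, ginv G b x p q * ∑ r, ∑ s, ginv G b x r s *
        (rm4 G b x ![j, k, i, s] * rm4 G b x ![p, r, m, q]) ∧
    rrField G b rrEquiv₆ x ![j, k, i, m] = ∑ p, ∑ q, ginv G b x p q * ∑ r, ∑ s, ginv G b x r s *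
        (rm4 G b x ![j, k, m, s] * rm4 G b x ![p, i, r, q]) := by
  refine ⟨?_, ?_, ?_, ?_, ?_, ?_⟩ <;> exact ttr_ttr_treindex_tprod b _ _ _ x _

end Monomials

/-! ### The base case: `∂_t Rm − ΔRm = Rm * Rm` (Topping, Prop. 2.5.1) -/

section Base

variable [Fintype ι] {G : E → E →L[ℝ] E →L[ℝ] ℝ} (b : Basis ι ℝ E) {V : Set E} {x : E} [FiniteDimensional ℝ E]

/-- The quadratic curvature expression `Q` as a component field: `quadField x J = Q(b_{J0},b_{J1},b_{J2},b_{J3})`.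
[cite: Topping2006, §2.4, (2.4.2)] -/
def quadField (G : E → E →L[ℝ] E →L[ℝ] ℝ) (b : Basis ι ℝ E) : E → (Fin 4 → ι) → ℝ :=
  fun x J ↦ quadRiemAt G b x (b (J 0)) (b (J 1)) (b (J 2)) (b (J 3))

/-- `Ric(R(b_{J0},b_{J1})b_{J2}, b_{J3})` as a component field. [cite: Topping2006, Prop. 2.5.1] -/
def ricRField₁ (G : E → E →L[ℝ] E →L[ℝ] ℝ) (b : Basis ι ℝ E) : E → (Fin 4 → ι) → ℝ :=
  fun x J ↦ ricAt G x (riemAt G x (b (J 0)) (b (J 1)) (b (J 2))) (b (J 3))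

/-- `Ric(b_{J2}, R(b_{J0},b_{J1})b_{J3})` as a component field. [cite: Topping2006, Prop. 2.5.1] -/
def ricRField₂ (G : E → E →L[ℝ] E →L[ℝ] ℝ) (b : Basis ι ℝ E) : E → (Fin 4 → ι) → ℝ :=
  fun x J ↦ ricAt G x (b (J 2)) (riemAt G x (b (J 0)) (b (J 1)) (b (J 3)))

/-- **`Q` is a combination of the four monomials**: `Q = Q₁ − Q₂ − Q₃ − Q₄` at points where `G x` is
invertible. [cite: Topping2006, §2.4, (2.4.2)] -/
theorem quadField_eq (hx : (G x).IsInvertible) (j k i m : ι) :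
    quadField G b x ![j, k, i, m] = rrField G b rrEquiv₁ x ![j, k, i, m] - rrField G b rrEquiv₂ x ![j, k, i, m]
      - rrField G b rrEquiv₃ x ![j, k, i, m] - rrField G b rrEquiv₄ x ![j, k, i, m] := by
  obtain ⟨h1, h2, h3, h4, -, -⟩ := rrField_apply_all b x j k i m
  rw [h1, h2, h3, h4, ← Finset.sum_sub_distrib, ← Finset.sum_sub_distrib, ← Finset.sum_sub_distrib]
  change quadRiemAt G b x (b j) (b k) (b i) (b m) = _
  rw [quadRiemAt]
  refine Finset.sum_congr rfl fun p _ ↦ ?_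
  rw [← Finset.sum_sub_distrib, ← Finset.sum_sub_distrib, ← Finset.sum_sub_distrib]
  refine Finset.sum_congr rfl fun q _ ↦ ?_
  rw [← mul_sub, ← mul_sub, ← mul_sub]
  congr 1
  -- the four terms
  have eT1 : G x (riemAt G x (b p) (b j) (riemAt G x (b k) (b q) (b i))) (b m) =
      ∑ r, ∑ s, ginv G b x r s * (rm4 G b x ![k, q, i, s] * rm4 G b x ![p, j, r, m]) := by
    rw [riemAt_basis_eq_sum b x k q i, map_sum, map_sum, _root_.sum_apply]
    refine Finset.sum_congr rfl fun r _ ↦ ?_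
    rw [map_smul, map_smul, _root_.smul_apply, smul_eq_mul, riemCoef_eq_sum_ginv b hx, Finset.sum_mul]
    exact Finset.sum_congr rfl fun s _ ↦ by rw [rm4_vec, rm4_vec]; ring
  have eT2 : G x (riemAt G x (b k) (b q) (riemAt G x (b p) (b j) (b i))) (b m) =
      ∑ r, ∑ s, ginv G b x r s * (rm4 G b x ![p, j, i, s] * rm4 G b x ![k, q, r, m]) := by
    rw [riemAt_basis_eq_sum b x p j i, map_sum, map_sum, _root_.sum_apply]
    refine Finset.sum_congr rfl fun r _ ↦ ?_
    rw [map_smul, map_smul, _root_.smul_apply, smul_eq_mul, riemCoef_eq_sum_ginv b hx, Finset.sum_mul]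
    exact Finset.sum_congr rfl fun s _ ↦ by rw [rm4_vec, rm4_vec]; ring
  have eT3 : G x (riemAt G x (riemAt G x (b p) (b j) (b k)) (b q) (b i)) (b m) =
      ∑ r, ∑ s, ginv G b x r s * (rm4 G b x ![p, j, k, s] * rm4 G b x ![r, q, i, m]) := by
    rw [riemAt_basis_eq_sum b x p j k, ← riemCLM_apply, map_sum, _root_.sum_apply, _root_.sum_apply, map_sum,
      _root_.sum_apply]
    refine Finset.sum_congr rfl fun r _ ↦ ?_
    rw [map_smul, _root_.smul_apply, _root_.smul_apply, map_smul, _root_.smul_apply, smul_eq_mul, riemCLM_apply,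
      riemCoef_eq_sum_ginv b hx, Finset.sum_mul]
    exact Finset.sum_congr rfl fun s _ ↦ by rw [rm4_vec, rm4_vec]; ring
  have eT4 : G x (riemAt G x (b k) (riemAt G x (b p) (b j) (b q)) (b i)) (b m) =
      ∑ r, ∑ s, ginv G b x r s * (rm4 G b x ![p, j, q, s] * rm4 G b x ![k, r, i, m]) := by
    rw [riemAt_basis_eq_sum b x p j q, ← riemCLM_apply, map_sum, _root_.sum_apply, map_sum, _root_.sum_apply]
    refine Finset.sum_congr rfl fun r _ ↦ ?_
    rw [map_smul, _root_.smul_apply, map_smul, _root_.smul_apply, smul_eq_mul, riemCLM_apply,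
      riemCoef_eq_sum_ginv b hx, Finset.sum_mul]
    exact Finset.sum_congr rfl fun s _ ↦ by rw [rm4_vec, rm4_vec]; ring
  rw [← eT1, ← eT2, ← eT3, ← eT4]
  simp only [map_sub, _root_.sub_apply, ContinuousLinearMap.comp_apply]

/-- **`Ric(R(b_j,b_k)b_i, b_m)` is the monomial `Q₅`** (invertible `G x`). [cite: Topping2006, Prop. 2.5.1] -/
theorem ricRField₁_eq (hx : (G x).IsInvertible) (j k i m : ι) :
    ricRField₁ G b x ![j, k, i, m] = rrField G b rrEquiv₅ x ![j, k, i, m] := by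
  obtain ⟨-, -, -, -, h5, -⟩ := rrField_apply_all b x j k i m
  rw [h5]
  change ricAt G x (riemAt G x (b j) (b k) (b i)) (b m) = _
  rw [riemAt_basis_eq_sum b x j k i, map_sum, _root_.sum_apply]
  simp only [map_smul, _root_.smul_apply, smul_eq_mul]
  simp only [riemCoef_eq_sum_ginv b hx, ricAt_eq_sum_ginv b hx, rm4_vec]
  symm
  simp only [Finset.mul_sum]
  rw [sum_comm₃' fun (p q r : ι) ↦ ∑ s, ginv G b x p q * (ginv G b x r s *
    (G x (riemAt G x (b j) (b k) (b i)) (b s) * G x (riemAt G x (b p) (b r) (b m)) (b q)))]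
  refine Finset.sum_congr rfl fun r _ ↦ Finset.sum_congr rfl fun p _ ↦ Finset.sum_congr rfl fun q _ ↦ ?_
  rw [Finset.sum_mul]
  exact Finset.sum_congr rfl fun s _ ↦ by ring

/-- **`Ric(b_i, R(b_j,b_k)b_m)` is the monomial `Q₆`** (invertible `G x`). [cite: Topping2006, Prop. 2.5.1] -/
theorem ricRField₂_eq (hx : (G x).IsInvertible) (j k i m : ι) :
    ricRField₂ G b x ![j, k, i, m] = rrField G b rrEquiv₆ x ![j, k, i, m] := by
  obtain ⟨-, -, -, -, -, h6⟩ := rrField_apply_all b x j k i m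
  rw [h6]
  change ricAt G x (b i) (riemAt G x (b j) (b k) (b m)) = _
  rw [riemAt_basis_eq_sum b x j k m, map_sum]
  simp only [map_smul, smul_eq_mul]
  simp only [riemCoef_eq_sum_ginv b hx, ricAt_eq_sum_ginv b hx, rm4_vec]
  symm
  simp only [Finset.mul_sum]
  rw [sum_comm₃' fun (p q r : ι) ↦ ∑ s, ginv G b x p q * (ginv G b x r s *
    (G x (riemAt G x (b j) (b k) (b m)) (b s) * G x (riemAt G x (b p) (b i) (b r)) (b q)))]
  refine Finset.sum_congr rfl fun r _ ↦ Finset.sum_congr rfl fun p _ ↦ Finset.sum_congr rfl fun q _ ↦ ?_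
  rw [Finset.sum_mul]
  exact Finset.sum_congr rfl fun s _ ↦ by ring

end Base

/-! ### `curvL 0 ∈ StarQuad 0` -/

namespace IsMetricFamilyOn

section BaseFlow

variable [Fintype ι] {G : ℝ → E → E →L[ℝ] E →L[ℝ] ℝ} {S : Set ℝ} {V : Set E} {x : E} {t : ℝ}
  (b : Basis ι ℝ E) [FiniteDimensional ℝ E] [CompleteSpace E]
  (hG : IsMetricFamilyOn G S V)
  (hfl : ∀ s ∈ S, ∀ y ∈ V, tDeriv G S s y = (-2 : ℝ) • ricAt (G s) y)
include hG hfl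

/-- **`∂_tRm − ΔRm` explicitly** (Topping, Prop. 2.5.1 in components): on `V × S`,
`curvL 0 = Q − Q ∘ (01) − Ric(R·,·) + Ric(·, R·)`. [cite: Topping2006, Prop. 2.5.1] -/
theorem curvL_zero_apply (hx : x ∈ V) (ht : t ∈ S) (J : Fin 4 → ι) :
    curvL G S b 0 t x J = quadField (G t) b x J - quadField (G t) b x (J ∘ Equiv.swap (0 : Fin 4) 1)
      - ricRField₁ (G t) b x J + ricRField₂ (G t) b x J := by
  have hGt := hG.isMetricOn t ht
  rw [eq_vec4 J]
  have hsw : (![J 0, J 1, J 2, J 3] ∘ (Equiv.swap (0 : Fin 4) 1) : Fin 4 → ι) = ![J 1, J 0, J 2, J 3] := by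
    funext c
    fin_cases c
    · simp
    · simp
    · rw [Function.comp_apply, Equiv.swap_apply_of_ne_of_ne (by decide) (by decide)]; rfl
    · rw [Function.comp_apply, Equiv.swap_apply_of_ne_of_ne (by decide) (by decide)]; rfl
  rw [hsw, curvL, tder_apply]
  change derivWithin (fun s ↦ G s x (riemAt (G s) x (b (J 0)) (b (J 1)) (b (J 2))) (b (J 3))) S t - _ = _
  rw [(hG.hasDerivWithinAt_apply_riemAt_ricciFlow b hfl hx ht (b (J 0)) (b (J 1)) (b (J 2)) (b (J 3))).derivWithin
    (hG.uniqueDiffOn t ht)]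
  change _ - tlap (G t) b (rm4 (G t) b) x ![J 0, J 1, J 2, J 3] = _
  rw [hGt.tlap_rm4 b hx]
  simp only [quadField, ricRField₁, ricRField₂, Matrix.cons_val_zero, Matrix.cons_val_one, Matrix.cons_val]
  ring

/-- **The base case `curvL 0 ∈ StarQuad 0`**: `∂_tRm − ΔRm = Rm * Rm` (Topping, Remark 2.5.2),
with the quadratic terms written as double traces of relabelled `Rm ⊗ Rm`. [cite: Topping2006, Prop. 2.5.1] -/
theorem starQuad_curvL_zero : StarQuad G S V b 0 (Fin (4 + 0)) (curvL G S b 0) := by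
  have hrr : ∀ e : Fin 4 ⊕ Fin 4 ≃ Option (Option (Option (Option (Fin 4)))),
      StarQuad G S V b 0 (Fin 4) (fun s ↦ rrField (G s) b e) := fun e ↦
    ((StarQuad.prod (G := G) (S := S) (V := V) (b := b) 0 0).reindex e).tr.tr
  have hQ : StarQuad G S V b 0 (Fin 4) (fun s ↦ quadField (G s) b) := by
    refine ((((hrr rrEquiv₁).sub (hrr rrEquiv₂)).sub (hrr rrEquiv₃)).sub (hrr rrEquiv₄)).eqOn
      fun s hs y hy J ↦ ?_
    rw [eq_vec4 J, quadField_eq b ((hG.isMetricOn s hs).isInvertible y hy)]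
    rfl
  have hR₁ : StarQuad G S V b 0 (Fin 4) (fun s ↦ ricRField₁ (G s) b) := by
    refine (hrr rrEquiv₅).eqOn fun s hs y hy J ↦ ?_
    rw [eq_vec4 J, ricRField₁_eq b ((hG.isMetricOn s hs).isInvertible y hy)]
  have hR₂ : StarQuad G S V b 0 (Fin 4) (fun s ↦ ricRField₂ (G s) b) := by
    refine (hrr rrEquiv₆).eqOn fun s hs y hy J ↦ ?_
    rw [eq_vec4 J, ricRField₂_eq b ((hG.isMetricOn s hs).isInvertible y hy)]
  refine (((hQ.sub (hQ.reindex (Equiv.swap (0 : Fin 4) 1))).sub hR₁).add hR₂).eqOn fun s hs y hy J ↦ ?_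
  rw [hG.curvL_zero_apply b hfl hy hs]
  rfl

end BaseFlow

end IsMetricFamilyOn

/-! ### The induction step: `∂_t∇ − ∇∂_t`, `[∇, Δ]` and the `∂_tΓ` term as `*`-fields -/

section GamEquiv

variable {α : Type*} [DecidableEq α]

/-- The relabelling behind the `∂_tΓ * T` term: forward map. [folklore] -/
def gamEquivFun (a : α) : Option (Fin 2) ⊕ α → Option (Option (Option α))
  | Sum.inl none => some (some none)
  | Sum.inl (some i) => ![some (some (some a)), some none] i
  | Sum.inr a' => if a' = a then none else some (some (some a'))

/-- The relabelling behind the `∂_tΓ * T` term: inverse map. [folklore] -/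
def gamEquivInv (a : α) : Option (Option (Option α)) → Option (Fin 2) ⊕ α
  | none => Sum.inr a
  | some none => Sum.inl (some 1)
  | some (some none) => Sum.inl none
  | some (some (some a')) => if a' = a then Sum.inl (some 0) else Sum.inr a'

/-- **The relabelling `Option (Fin 2) ⊕ α ≃ Option³ α`** for the `∂_tΓ * T` term. [folklore] -/
def gamEquiv (a : α) : Option (Fin 2) ⊕ α ≃ Option (Option (Option α)) where
  toFun := gamEquivFun a
  invFun := gamEquivInv a
  left_inv := by
    rintro ((_ | i) | a')
    · rfl
    · fin_cases i <;> simp [gamEquivFun, gamEquivInv]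
    · by_cases h : a' = a
      · subst h; simp [gamEquivFun, gamEquivInv]
      · simp [gamEquivFun, gamEquivInv, h]
  right_inv := by
    rintro (_ | _ | _ | a')
    · simp [gamEquivFun, gamEquivInv]
    · simp [gamEquivFun, gamEquivInv]
    · simp [gamEquivFun, gamEquivInv]
    · by_cases h : a' = a
      · subst h; simp [gamEquivFun, gamEquivInv]
      · simp [gamEquivFun, gamEquivInv, h]

variable {ι : Type*}

/-- The slots under `gamEquiv a`. [folklore] -/
theorem ocons₃_comp_gamEquiv (a : α) (m l j : ι) (I : α → ι) :
    (ocons m (ocons l (ocons j I)) ∘ gamEquiv a) ∘ Sum.inl = ocons j ![I a, l] ∧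
      (ocons m (ocons l (ocons j I)) ∘ gamEquiv a) ∘ Sum.inr = update I a m := by
  constructor
  · funext o
    rcases o with _ | i
    · rfl
    · fin_cases i <;> rfl
  · funext a'
    by_cases h : a' = a
    · subst h; simp [gamEquiv, gamEquivFun]
    · rw [update_of_ne h]; simp [gamEquiv, gamEquivFun, h]

/-- The relabelling `K(i,j,l)` of a rank-three kernel `K(j,i,l)` (swap of the first two slots). [folklore] -/
def kerSwap₁₂ : Option (Fin 2) ≃ Option (Fin 2) := Equiv.swap none (some 0)

/-- The relabelling `K(l,j,i)` of a rank-three kernel `K(j,i,l)`. [folklore] -/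
def kerCyc : Option (Fin 2) ≃ Option (Fin 2) where
  toFun
    | none => some 1
    | some i => ![none, some 0] i
  invFun
    | none => some 0
    | some i => ![some 1, none] i
  left_inv := by
    rintro (_ | i)
    · rfl
    · fin_cases i <;> rfl
  right_inv := by
    rintro (_ | i)
    · rfl
    · fin_cases i <;> rfl

/-- `(j, i, l) ∘ kerSwap₁₂ = (i, j, l)`. [folklore] -/
theorem ocons_vec2_comp_kerSwap (j i l : ι) : ocons j ![i, l] ∘ kerSwap₁₂ = ocons i ![j, l] := by
  funext o
  rcases o with _ | c
  · rfl
  · fin_cases c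
    · rfl
    · show ocons j ![i, l] (Equiv.swap none (some 0) (some 1)) = l
      rw [Equiv.swap_apply_of_ne_of_ne (by simp) (by simp)]
      rfl

/-- `(j, i, l) ∘ kerCyc = (l, j, i)`. [folklore] -/
theorem ocons_vec2_comp_kerCyc (j i l : ι) : ocons j ![i, l] ∘ kerCyc = ocons l ![j, i] := by
  funext o
  rcases o with _ | c
  · rfl
  · fin_cases c <;> rfl

/-- Nonemptiness of the index type `Fin (4 + k)`. [folklore] -/
theorem univ_fin4k_nonempty (k : ℕ) : (Finset.univ : Finset (Fin (4 + k))).Nonempty :=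
  Finset.univ_nonempty_iff.2 ⟨⟨0, by omega⟩⟩

end GamEquiv

namespace IsMetricFamilyOn

section StepFlow

variable [Fintype ι] {G : ℝ → E → E →L[ℝ] E →L[ℝ] ℝ} {S : Set ℝ} {V : Set E} {x : E} {t : ℝ}
  (b : Basis ι ℝ E) [FiniteDimensional ℝ E] [CompleteSpace E]
  (hG : IsMetricFamilyOn G S V)
  (hfl : ∀ s ∈ S, ∀ y ∈ V, tDeriv G S s y = (-2 : ℝ) • ricAt (G s) y)
include hG hfl

/-- The rank-three kernel of `∂_tΓ` under the flow:
`K_c(j,i,l) = (∇_jRic)(b_i,b_l) + (∇_iRic)(b_j,b_l) − (∇_lRic)(b_j,b_i)`. [cite: Topping2006, Prop. 2.3.1] -/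
def kerField (G : ℝ → E → E →L[ℝ] E →L[ℝ] ℝ) (b : Basis ι ℝ E) (s : ℝ) : E → (Option (Fin 2) → ι) → ℝ :=
  tcov (G s) b (ric2 (G s) b) + treindex kerSwap₁₂ (tcov (G s) b (ric2 (G s) b))
    - treindex kerCyc (tcov (G s) b (ric2 (G s) b))

omit [CompleteSpace E] hG hfl in
/-- Unfolding lemma for `kerField`. [cite: Topping2006, Prop. 2.3.1] -/
theorem kerField_apply_ocons (s : ℝ) (y : E) (j i l : ι) :
    kerField G b s y (ocons j ![i, l]) = tcov (G s) b (ric2 (G s) b) y (ocons j ![i, l])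
      + tcov (G s) b (ric2 (G s) b) y (ocons i ![j, l]) - tcov (G s) b (ric2 (G s) b) y (ocons l ![j, i]) := by
  simp only [kerField, Pi.add_apply, Pi.sub_apply, treindex_apply, ocons_vec2_comp_kerSwap, ocons_vec2_comp_kerCyc]

/-- `∂_tΓ^m_{ji} = −Σ_l g^{ml} K_c(j,i,l)` under the flow. [cite: Topping2006, Prop. 2.3.1] -/
theorem chrDot_eq_kerField (hx : x ∈ V) (ht : t ∈ S) (j i m : ι) :
    chrDot G S b t x j i m = -∑ l, ginv (G t) b x m l * kerField G b t x (ocons j ![i, l]) := by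
  rw [hG.chrDot_ricciFlow b hfl hx ht]
  simp only [kerField_apply_ocons]

/-- **The `∂_tΓ * T` term is a sum of traces of relabelled products `K_c ⊗ T`**:
`Σ_a Σ_m ∂_tΓ^m_{jI_a} T_{I[a↦m]} = −Σ_a tr ((K_c ⊗ T) ∘ gamEquiv a)_{jI}`. [cite: Topping2006, §2.3, (2.3.3)] -/
theorem sum_chrDot_mul_eq {α : Type*} [Fintype α] [DecidableEq α] (hx : x ∈ V) (ht : t ∈ S)
    (T : E → (α → ι) → ℝ) (j : ι) (I : α → ι) :
    ∑ a, ∑ m, chrDot G S b t x j (I a) m * T x (update I a m) =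
      -∑ a, ttr (G t) b (treindex (gamEquiv a) (tprod (kerField G b t) T)) x (ocons j I) := by
  rw [← Finset.sum_neg_distrib]
  refine Finset.sum_congr rfl fun a _ ↦ ?_
  rw [ttr_apply, ← Finset.sum_neg_distrib]
  refine Finset.sum_congr rfl fun m _ ↦ ?_
  rw [hG.chrDot_eq_kerField b hfl hx ht, neg_mul, Finset.sum_mul, ← Finset.sum_neg_distrib, ← Finset.sum_neg_distrib]
  refine Finset.sum_congr rfl fun l _ ↦ ?_
  rw [treindex_apply, tprod_apply, (ocons₃_comp_gamEquiv a m l j I).1, (ocons₃_comp_gamEquiv a m l j I).2]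
  ring

variable {k : ℕ}

omit hfl in
/-- **`curvL (k+1)` through `curvL k`** (the induction step in components): on `V × S`,
`curvL (k+1) = [∇(curvL k) − tr(∇ W(∇^kRm) + W(∇^{k+1}Rm) ∘ σ) − Σ_a Σ_m ∂_tΓ · ∇^kRm] ∘ idxEquiv`,
with `W = tcov2Alt` (the Ricci identity) — Topping's (3.3.3) before rewriting the lower-order terms
as `*`-products. [cite: Topping2006, §3.3, (3.3.3)] -/
theorem curvL_succ_apply (ht₀ : t ∈ S) {s : ℝ} (hs : s ∈ S) {y : E} (hy : y ∈ V) (J : Fin (4 + (k + 1)) → ι) :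
    curvL G S b (k + 1) s y J =
      tcov (G s) b (curvL G S b k s) y (J ∘ idxEquiv k)
      - ttr (G s) b (tcov (G s) b (tcov2Alt (G s) b (curvD G b k s))
          + treindex (Equiv.swap (some none) (some (some none)))
              (tcov2Alt (G s) b (tcov (G s) b (curvD G b k s)))) y (J ∘ idxEquiv k)
      - ∑ a, ∑ m, chrDot G S b s y ((J ∘ idxEquiv k) none) ((J ∘ idxEquiv k) (some a)) m *
          curvD G b k s y (update ((J ∘ idxEquiv k) ∘ some) a m) := by
  have hV := hG.isOpen hs
  have hGs := hG.isMetricOn s hs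
  have hD := hG.tsmoothFamOn_curvD b k
  have hDs := hD.slice hs
  have hLs := (hG.tsmoothFamOn_curvL b ht₀ k).slice hs
  have hlapDs := (hG.tsmoothFamOn_tlap b hD).slice hs
  set J' := J ∘ idxEquiv k with hJ'
  -- `curvL (k+1)` through the raw field at `J'`
  have h1 : curvL G S b (k + 1) s y J =
      derivWithin (fun s' ↦ tcov (G s') b (curvD G b k s') y J') S s
        - tlap (G s) b (tcov (G s) b (curvD G b k s)) y J' := by
    rw [curvL, tder_apply, curvD_succ, tlap_treindex]
    rfl
  -- `∂_t ∇ = ∇ ∂_t − ∂_tΓ *`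
  have h2 : derivWithin (fun s' ↦ tcov (G s') b (curvD G b k s') y J') S s =
      tcov (G s) b (tder (curvD G b k) S s) y J'
        - ∑ a, ∑ m, chrDot G S b s y (J' none) (J' (some a)) m * curvD G b k s y (update (J' ∘ some) a m) :=
    (hG.hasDerivWithinAt_tcov b hD hy hs J').derivWithin (hG.uniqueDiffOn s hs)
  -- `∂_t ∇^kRm = Δ∇^kRm + curvL k`
  have h3 : tder (curvD G b k) S s = tlap (G s) b (curvD G b k s) + curvL G S b k s := by
    funext z I; exact tder_curvD b k s z I
  have h4 : tcov (G s) b (tder (curvD G b k) S s) y J' =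
      tcov (G s) b (tlap (G s) b (curvD G b k s)) y J' + tcov (G s) b (curvL G S b k s) y J' := by
    rw [h3, tcov_add_apply hV hlapDs hLs hy]
  -- the commutator `[Δ, ∇]`
  have h5 : tlap (G s) b (tcov (G s) b (curvD G b k s)) y J' - tcov (G s) b (tlap (G s) b (curvD G b k s)) y J' =
      ttr (G s) b (tcov (G s) b (tcov2Alt (G s) b (curvD G b k s))
        + treindex (Equiv.swap (some none) (some (some none)))
            (tcov2Alt (G s) b (tcov (G s) b (curvD G b k s)))) y J' := by
    rw [← ocons_eta J']
    exact hGs.tlap_tcov_sub_tcov_tlap hDs hy (J' none) (J' ∘ some)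
  rw [h1, h2, h4]
  linarith [h5]


omit hfl in
/-- **`W(∇^kRm) = ∇∇(∇^kRm) − (∇∇(∇^kRm))∘swap ∈ StarQuad k`** (the Ricci identity `W(T) = −Σ_a Rm ⋆_a T`).
[cite: Topping2006, §2.1, (2.1.5)] -/
theorem starQuad_tcov2Alt_curvD (k : ℕ) :
    StarQuad G S V b k (Option (Option (Fin (4 + k)))) (fun s ↦ tcov2Alt (G s) b (curvD G b k s)) := by
  have hterm : ∀ a : Fin (4 + k), StarQuad G S V b k (Option (Option (Fin (4 + k))))
      (fun s ↦ ttr (G s) b (treindex (ricEquiv a) (tprod (rm4 (G s) b) (curvD G b k s)))) := fun a ↦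
    (((StarQuad.prod (G := G) (S := S) (V := V) (b := b) 0 k).cast (Nat.zero_add k)).reindex (ricEquiv a)).tr
  refine ((StarQuad.sum Finset.univ (fun a _ ↦ hterm a) (univ_fin4k_nonempty k)).neg).eqOn fun s hs y hy J ↦ ?_
  have hGs := hG.isMetricOn s hs
  rw [hGs.tcov2Alt_eq ((hG.tsmoothFamOn_curvD b k).slice hs) y hy J]
  simp only [Pi.neg_apply, Finset.sum_apply]
  congr 1
  exact Finset.sum_congr rfl fun a _ ↦ hGs.ricTerm_eq_ttr (curvD G b k s) a y hy J

omit hfl in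
/-- `W(∇(∇^kRm)) ∈ StarQuad (k+1)`. [cite: Topping2006, §2.1, (2.1.5)] -/
theorem starQuad_tcov2Alt_tcov_curvD (k : ℕ) :
    StarQuad G S V b (k + 1) (Option (Option (Option (Fin (4 + k)))))
      (fun s ↦ tcov2Alt (G s) b (tcov (G s) b (curvD G b k s))) := by
  have hterm : ∀ a : Option (Fin (4 + k)), StarQuad G S V b (k + 1) (Option (Option (Option (Fin (4 + k)))))
      (fun s ↦ ttr (G s) b (treindex (ricEquiv a) (tprod (rm4 (G s) b) (tcov (G s) b (curvD G b k s))))) := by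
    intro a
    have h0 := ((((StarQuad.prod (G := G) (S := S) (V := V) (b := b) 0 (k + 1)).cast (Nat.zero_add (k + 1))).reindex
      ((Equiv.refl (Fin (4 + 0))).sumCongr (idxEquiv k).symm)).reindex (ricEquiv a)).tr
    refine h0.eqOn fun s _ y _ J ↦ ?_
    rw [tcov_curvD, tprod_treindex_right]
    rfl
  have hne : (Finset.univ : Finset (Option (Fin (4 + k)))).Nonempty := Finset.univ_nonempty_iff.2 ⟨none⟩
  refine ((StarQuad.sum Finset.univ (fun a _ ↦ hterm a) hne).neg).eqOn fun s hs y hy J ↦ ?_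
  have hGs := hG.isMetricOn s hs
  have hsm : TSmoothOn (tcov (G s) b (curvD G b k s)) V := hGs.tsmoothOn_tcov ((hG.tsmoothFamOn_curvD b k).slice hs)
  rw [hGs.tcov2Alt_eq hsm y hy J]
  simp only [Pi.neg_apply, Finset.sum_apply]
  congr 1
  exact Finset.sum_congr rfl fun a _ ↦ hGs.ricTerm_eq_ttr _ a y hy J

omit hfl in
/-- **`K_c ⊗ ∇^kRm ∈ StarQuad (k+1)`**: the kernel `K_c` of `∂_tΓ` is a relabelled trace of `∇Rm`
(`∇Ric = tr ∇Rm`), so its product with `∇^kRm` is a relabelled trace of `∇Rm ⊗ ∇^kRm`.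
[cite: Topping2006, Prop. 2.3.1] -/
theorem starQuad_tprod_kerField_curvD (k : ℕ) :
    StarQuad G S V b (k + 1) (Option (Fin 2) ⊕ Fin (4 + k)) (fun s ↦ tprod (kerField G b s) (curvD G b k s)) := by
  -- `∇ ric2` as a trace of the relabelled `∇Rm`
  set eK : Fin (4 + (0 + 1)) ≃ Option (Option (Option (Fin 2))) :=
    ((idxEquiv 0).symm.trans (ricTraceEquiv.optionCongr)).trans (cycTop (Fin 2)) with heK
  have hK : ∀ s ∈ S, ∀ y ∈ V, ∀ K : Option (Fin 2) → ι, tcov (G s) b (ric2 (G s) b) y K =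
      ttr (G s) b (treindex eK (curvD G b 1 s)) y K := by
    intro s hs y hy K
    have hGs := hG.isMetricOn s hs
    have hrm : TSmoothOn (rm4 (G s) b) V := hGs.tsmoothOn_rm4 b
    rw [tcov_congr hGs.isOpen (fun z hz I ↦ ric2_eq_ttr b (hGs.isInvertible z hz) I) hy K,
      hGs.tcov_ttr_eq (hrm.treindex _) hy K, tcov_treindex, ← curvD_zero, tcov_curvD, treindex_treindex,
      treindex_treindex]
    rfl
  have hX : StarQuad G S V b (1 + k) (Option (Fin 2) ⊕ Fin (4 + k))
      (fun s ↦ tprod (ttr (G s) b (treindex eK (curvD G b 1 s))) (curvD G b k s)) := by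
    have h0 := (((StarQuad.prod (G := G) (S := S) (V := V) (b := b) 1 k).reindex
      (eK.sumCongr (Equiv.refl (Fin (4 + k))))).reindex (sumOption₂Left (Option (Fin 2)) (Fin (4 + k)))).tr
    refine h0.eqOn fun s _ y _ K ↦ ?_
    rw [ttr_tprod, tprod_treindex_left]
  have hK1 : StarQuad G S V b (1 + k) (Option (Fin 2) ⊕ Fin (4 + k))
      (fun s ↦ tprod (tcov (G s) b (ric2 (G s) b)) (curvD G b k s)) :=
    hX.eqOn fun s hs y hy K ↦ by rw [tprod_apply, tprod_apply, hK s hs y hy]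
  have hK2 : StarQuad G S V b (1 + k) (Option (Fin 2) ⊕ Fin (4 + k))
      (fun s ↦ tprod (treindex kerSwap₁₂ (tcov (G s) b (ric2 (G s) b))) (curvD G b k s)) :=
    (hK1.reindex (kerSwap₁₂.sumCongr (Equiv.refl _))).eqOn fun s _ y _ K ↦ by rw [tprod_treindex_left]
  have hK3 : StarQuad G S V b (1 + k) (Option (Fin 2) ⊕ Fin (4 + k))
      (fun s ↦ tprod (treindex kerCyc (tcov (G s) b (ric2 (G s) b))) (curvD G b k s)) :=
    (hK1.reindex (kerCyc.sumCongr (Equiv.refl _))).eqOn fun s _ y _ K ↦ by rw [tprod_treindex_left]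
  refine (((hK1.add hK2).sub hK3).cast (by ring)).eqOn fun s _ y _ K ↦ ?_
  simp only [kerField, tprod_add_left, tprod_sub_left, Pi.add_apply, Pi.sub_apply]

/-- **The `∂_tΓ * ∇^kRm` term ∈ StarQuad (k+1).** [cite: Topping2006, §2.3, (2.3.3)] -/
theorem starQuad_gam_curvD (k : ℕ) :
    StarQuad G S V b (k + 1) (Option (Fin (4 + k))) (fun s y J' ↦
      ∑ a, ∑ m, chrDot G S b s y (J' none) (J' (some a)) m * curvD G b k s y (update (J' ∘ some) a m)) := by
  have hKT := hG.starQuad_tprod_kerField_curvD b k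
  have hterm : ∀ a : Fin (4 + k), StarQuad G S V b (k + 1) (Option (Fin (4 + k)))
      (fun s ↦ ttr (G s) b (treindex (gamEquiv a) (tprod (kerField G b s) (curvD G b k s)))) := fun a ↦
    (hKT.reindex (gamEquiv a)).tr
  refine ((StarQuad.sum Finset.univ (fun a _ ↦ hterm a) (univ_fin4k_nonempty k)).neg).eqOn fun s hs y hy J' ↦ ?_
  simp only [Pi.neg_apply, Finset.sum_apply]
  have h := hG.sum_chrDot_mul_eq b hfl hy hs (curvD G b k s) (J' none) (J' ∘ some)
  rw [ocons_eta] at h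
  exact h

/-- **The induction step `curvL k ∈ StarQuad k ⟹ curvL (k+1) ∈ StarQuad (k+1)`.**
[cite: Topping2006, §3.3, (3.3.3)] -/
theorem starQuad_curvL_succ (ht₀ : t ∈ S) (ih : StarQuad G S V b k (Fin (4 + k)) (curvL G S b k)) :
    StarQuad G S V b (k + 1) (Fin (4 + (k + 1))) (curvL G S b (k + 1)) := by
  have hL := ih.deriv hG ht₀
  have hW := ((hG.starQuad_tcov2Alt_curvD b k).deriv hG ht₀).add
    ((hG.starQuad_tcov2Alt_tcov_curvD b k).reindex (Equiv.swap (some none) (some (some none))))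
  have hGam := hG.starQuad_gam_curvD b hfl k
  have hF := (hL.sub hW.tr).sub hGam
  refine (hF.reindex (idxEquiv k)).eqOn fun s hs y hy J ↦ ?_
  rw [hG.curvL_succ_apply b ht₀ hs hy J, treindex_apply]
  rfl

/-- **`curvL k ∈ StarQuad k` for every `k`** — Topping's (3.3.3) `∂_t ∇^kRm = Δ∇^kRm + Σ_j ∇^jRm * ∇^{k−j}Rm`
with the `*`-structure of the lower-order terms made explicit. [cite: Topping2006, §3.3, (3.3.3)] -/
theorem starQuad_curvL (ht₀ : t ∈ S) (k : ℕ) : StarQuad G S V b k (Fin (4 + k)) (curvL G S b k) := by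
  induction k with
  | zero => exact hG.starQuad_curvL_zero b hfl
  | succ k ih => exact hG.starQuad_curvL_succ b hfl ht₀ ih

end StepFlow

end IsMetricFamilyOn

namespace IsMetricFamilyOn

section Scalar

variable [Fintype ι] {G : ℝ → E → E →L[ℝ] E →L[ℝ] ℝ} {S : Set ℝ} {V : Set E} {x : E} {t : ℝ}
  (b : Basis ι ℝ E) [FiniteDimensional ℝ E] [CompleteSpace E]
  (hG : IsMetricFamilyOn G S V)
  (hfl : ∀ s ∈ S, ∀ y ∈ V, tDeriv G S s y = (-2 : ℝ) • ricAt (G s) y)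
include hG hfl

omit hG hfl [CompleteSpace E] in
/-- `|T|²` only depends on the components at the point. [folklore] -/
theorem tnormSq_congr_point {α : Type*} [Fintype α] [DecidableEq α] {G₀ : E → E →L[ℝ] E →L[ℝ] ℝ}
    {T T' : E → (α → ι) → ℝ} (h : ∀ I, T x I = T' x I) : tnormSq G₀ b T x = tnormSq G₀ b T' x := by
  simp only [tnormSq_eq, tinner_apply, h]

omit hfl [CompleteSpace E] in
/-- **`|ricSlot_a T| ≤ n √|Rm|² |T|`** at positive definite points (`ricSlot` is a trace of
`Ric ⊗ T`, `Ric` a trace of `Rm`; `|tr X| ≤ √n |X|`). [cite: Topping2006, Prop. 3.2.10 (proof)] -/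
theorem sqrt_tnormSq_ricSlot_le {α : Type*} [Fintype α] [DecidableEq α] (ht : t ∈ S) (hx : x ∈ V)
    (hpos : ∀ v, v ≠ 0 → 0 < G t x v v) (T : E → (α → ι) → ℝ) (a : α) :
    Real.sqrt (tnormSq (G t) b (ricSlot (G t) b T a) x) ≤
      Fintype.card ι * Real.sqrt (tnormSq (G t) b (rm4 (G t) b) x) * Real.sqrt (tnormSq (G t) b T x) := by
  have hGt := hG.isMetricOn t ht
  have hs := hGt.symm x hx
  have hi := hGt.isInvertible x hx
  have hn : (0 : ℝ) ≤ Fintype.card ι := Nat.cast_nonneg _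
  -- `ricSlot = tr (Ric ⊗ T ∘ e)`
  have h1 : tnormSq (G t) b (ricSlot (G t) b T a) x =
      tnormSq (G t) b (ttr (G t) b (treindex (slotEquiv a) (tprod (ric2 (G t) b) T))) x :=
    tnormSq_congr_point b fun I ↦ ricSlot_eq_ttr b T a x I
  -- `ric2 = tr (Rm ∘ e')`
  have h2 : tnormSq (G t) b (ric2 (G t) b) x = tnormSq (G t) b (ttr (G t) b (treindex ricTraceEquiv (rm4 (G t) b))) x :=
    tnormSq_congr_point b fun I ↦ ric2_eq_ttr b hi I
  have hR : tnormSq (G t) b (ric2 (G t) b) x ≤ Fintype.card ι * tnormSq (G t) b (rm4 (G t) b) x := by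
    rw [h2]
    refine (tnormSq_ttr_le b hs hpos _).trans ?_
    rw [tnormSq_treindex]
  have hS : tnormSq (G t) b (ricSlot (G t) b T a) x ≤
      Fintype.card ι * (Fintype.card ι * tnormSq (G t) b (rm4 (G t) b) x) * tnormSq (G t) b T x := by
    rw [h1]
    refine (tnormSq_ttr_le b hs hpos _).trans ?_
    rw [tnormSq_treindex, tnormSq_tprod, ← mul_assoc]
    exact mul_le_mul_of_nonneg_right (mul_le_mul_of_nonneg_left hR hn) (tnormSq_nonneg b hs hpos _)
  have hsq : Fintype.card ι * (Fintype.card ι * tnormSq (G t) b (rm4 (G t) b) x) * tnormSq (G t) b T x =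
      (Fintype.card ι * Real.sqrt (tnormSq (G t) b (rm4 (G t) b) x) * Real.sqrt (tnormSq (G t) b T x)) ^ 2 := by
    rw [mul_pow, mul_pow, Real.sq_sqrt (tnormSq_nonneg b hs hpos _), Real.sq_sqrt (tnormSq_nonneg b hs hpos _)]
    ring
  rw [hsq] at hS
  have hnn : 0 ≤ Fintype.card ι * Real.sqrt (tnormSq (G t) b (rm4 (G t) b) x) * Real.sqrt (tnormSq (G t) b T x) :=
    mul_nonneg (mul_nonneg hn (Real.sqrt_nonneg _)) (Real.sqrt_nonneg _)
  calc Real.sqrt (tnormSq (G t) b (ricSlot (G t) b T a) x)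
      ≤ Real.sqrt ((Fintype.card ι * Real.sqrt (tnormSq (G t) b (rm4 (G t) b) x) *
          Real.sqrt (tnormSq (G t) b T x)) ^ 2) := Real.sqrt_le_sqrt hS
    _ = _ := Real.sqrt_sq hnn

/-- **The evolution inequality for `u_k = |∇^kRm|²` under the Ricci flow** (Topping 2006, (3.3.4)
for every `k`; Hamilton 1982, §13): there is `C ≥ 0` such that at every `(t, x) ∈ S × V` where
`G t x` is positive definite,
`∂_t u_k ≤ Δ u_k − 2 u_{k+1} + C (Σ_{p ≤ k} √u_p √u_{k−p}) √u_k + C √u_0 u_k`,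
with `∂_t` the derivative within `S`, `Δ = lapAt (G t)` the coordinate Laplace–Beltrami operator:
`∂_t|T|² = 2⟨∂_tT,T⟩ + 2Σ⟨Ric⋆T,T⟩` (`hasDerivWithinAt_tnormSq_ricciFlow`), `∂_tT = ΔT + L` with
`L ∈ StarQuad k` (`starQuad_curvL`, bounded by `StarQuad.norm_le`), and `Δ|T|² = 2⟨ΔT,T⟩ + 2|∇T|²`
(`lapAt_tnormSq`). [cite: Topping2006, §3.3, (3.3.4)] -/
theorem derivWithin_tnormSq_curvD_le (ht₀ : t ∈ S) (k : ℕ) :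
    ∃ C : ℝ, 0 ≤ C ∧ ∀ s ∈ S, ∀ y ∈ V, (∀ v, v ≠ 0 → 0 < G s y v v) →
      derivWithin (fun s' ↦ tnormSq (G s') b (curvD G b k s') y) S s ≤
        lapAt (G s) (tnormSq (G s) b (curvD G b k s)) y - 2 * tnormSq (G s) b (curvD G b (k + 1) s) y
        + C * (∑ p ∈ Finset.range (k + 1), Real.sqrt (tnormSq (G s) b (curvD G b p s) y) *
            Real.sqrt (tnormSq (G s) b (curvD G b (k - p) s) y)) * Real.sqrt (tnormSq (G s) b (curvD G b k s) y)
        + C * Real.sqrt (tnormSq (G s) b (curvD G b 0 s) y) * tnormSq (G s) b (curvD G b k s) y := by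
  obtain ⟨C₀, hC₀, hL⟩ := (hG.starQuad_curvL b hfl ht₀ k).norm_le
  refine ⟨max (2 * C₀) (2 * (Fintype.card (Fin (4 + k)) * Fintype.card ι)), le_max_of_le_left (by linarith), ?_⟩
  intro s hs y hy hpos
  have hGs := hG.isMetricOn s hs
  have hsy := hGs.symm y hy
  have hD := hG.tsmoothFamOn_curvD b k
  have hDs : TSmoothOn (curvD G b k s) V := hD.slice hs
  -- the time derivative
  have hder := (hG.hasDerivWithinAt_tnormSq_ricciFlow b hfl hD hy hs).derivWithin (hG.uniqueDiffOn s hs)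
  rw [hder]
  -- `∂_t D = ΔD + L`
  have h3 : tder (curvD G b k) S s = tlap (G s) b (curvD G b k s) + curvL G S b k s := by
    funext z I; exact tder_curvD b k s z I
  rw [h3, tinner_add_left]
  -- the Laplacian of `u_k`
  have hlap := hGs.lapAt_tnormSq (b := b) hDs hy
  have hk1 : tnormSq (G s) b (tcov (G s) b (curvD G b k s)) y = tnormSq (G s) b (curvD G b (k + 1) s) y := by
    rw [tcov_curvD, tnormSq_treindex]
  rw [hk1] at hlap
  -- bounds
  set uk := tnormSq (G s) b (curvD G b k s) y with huk
  have huk0 : 0 ≤ uk := tnormSq_nonneg b hsy hpos _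
  have hLb : tinner (G s) b (curvL G S b k s) (curvD G b k s) y ≤
      C₀ * (∑ p ∈ Finset.range (k + 1), Real.sqrt (tnormSq (G s) b (curvD G b p s) y) *
        Real.sqrt (tnormSq (G s) b (curvD G b (k - p) s) y)) * Real.sqrt uk := by
    refine (le_abs_self _).trans ((abs_tinner_le b hsy hpos _ _).trans ?_)
    exact mul_le_mul_of_nonneg_right (hL s hs y hy hsy hpos) (Real.sqrt_nonneg _)
  have hRb : ∑ a, tinner (G s) b (ricSlot (G s) b (curvD G b k s) a) (curvD G b k s) y ≤
      Fintype.card (Fin (4 + k)) * Fintype.card ι * Real.sqrt (tnormSq (G s) b (curvD G b 0 s) y) * uk := by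
    have hterm : ∀ a, tinner (G s) b (ricSlot (G s) b (curvD G b k s) a) (curvD G b k s) y ≤
        Fintype.card ι * Real.sqrt (tnormSq (G s) b (curvD G b 0 s) y) * uk := by
      intro a
      refine (le_abs_self _).trans ((abs_tinner_le b hsy hpos _ _).trans ?_)
      have h := hG.sqrt_tnormSq_ricSlot_le b hs hy hpos (curvD G b k s) a
      rw [curvD_zero]
      calc Real.sqrt (tnormSq (G s) b (ricSlot (G s) b (curvD G b k s) a) y) * Real.sqrt uk
          ≤ (Fintype.card ι * Real.sqrt (tnormSq (G s) b (rm4 (G s) b) y) * Real.sqrt uk) * Real.sqrt uk :=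
            mul_le_mul_of_nonneg_right h (Real.sqrt_nonneg _)
        _ = Fintype.card ι * Real.sqrt (tnormSq (G s) b (rm4 (G s) b) y) * uk := by
            rw [mul_assoc, Real.mul_self_sqrt huk0]
    calc ∑ a, tinner (G s) b (ricSlot (G s) b (curvD G b k s) a) (curvD G b k s) y
        ≤ ∑ _a : Fin (4 + k), Fintype.card ι * Real.sqrt (tnormSq (G s) b (curvD G b 0 s) y) * uk :=
          Finset.sum_le_sum fun a _ ↦ hterm a
      _ = _ := by rw [Finset.sum_const, Finset.card_univ, nsmul_eq_mul]; ring
  have hsum0 : 0 ≤ (∑ p ∈ Finset.range (k + 1), Real.sqrt (tnormSq (G s) b (curvD G b p s) y) *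
      Real.sqrt (tnormSq (G s) b (curvD G b (k - p) s) y)) * Real.sqrt uk :=
    mul_nonneg (Finset.sum_nonneg fun p _ ↦ mul_nonneg (Real.sqrt_nonneg _) (Real.sqrt_nonneg _)) (Real.sqrt_nonneg _)
  have hmax1 : 2 * C₀ ≤ max (2 * C₀) (2 * (Fintype.card (Fin (4 + k)) * Fintype.card ι)) := le_max_left _ _
  have hmax2 : 2 * (Fintype.card (Fin (4 + k)) * Fintype.card ι : ℝ) ≤
      max (2 * C₀) (2 * (Fintype.card (Fin (4 + k)) * Fintype.card ι)) := le_max_right _ _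
  have h0' : 0 ≤ Real.sqrt (tnormSq (G s) b (curvD G b 0 s) y) * uk := mul_nonneg (Real.sqrt_nonneg _) huk0
  nlinarith [hlap, hLb, hRb, hsum0, h0', hmax1, hmax2, mul_le_mul_of_nonneg_right hmax1 hsum0,
    mul_le_mul_of_nonneg_right hmax2 h0']

end Scalar

end IsMetricFamilyOn

end MetricCoord

end Literature.Geometry.Lorentzian

end
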